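import Mathlib
import Summits.ValiantsHypothesis.ValiantsHypothesis.Theorems.RigidityForcesSymmetryRankRigidMinimalReprLaplaceFiveStarMain

/-!
# ValiantsHypothesis / RigidityForcesSymmetry — crux `LaplaceOptimalFive` (stmt-ValiantsHypothesis-24813), crux idea
`young-shadow` (K1): **K1 ON THE STAR — `sideSym_starPairSplits`**
(memo `NOTE-p4g15-24813-K1-star.md` = the refereed paper proof (R332 PASS); memo `NOTE-p4g16-24813-LemmaK-kernel.md`)

THEOREM.  A side-symmetric split decomposition of the pattern `P₅` all of whose splits are PAIR splits forming a STAR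
(`{p,a},{p,b},{p,c},{p,d}`) has Laplace weight `≥ 5! = 120`, i.e. at least ten terms (✓ `star_profile_reduction` +
✓ `star_main`).  `LaplaceFivePropA.sideSym_starPairSplits` is the hub form named as the next rung of the young-shadow ladder
(`Cruxes/LaplaceOptimalFive/Lines/shallow_collision.lean`), complementing ✓ `sideSym_threePairSplits` and ✓ `sideSym_fourPairSplits_rigid`.

No definitions, no `sorry`.  Honest framing: K1 ON THE STAR only (side-symmetric sector, pair splits, four splits with a hub); not a registered stub of
`LaplaceOptimalFive` — helper, closes nothing; `LaplaceOptimalFive` OPEN · CONTESTED 72/120; `VP ≠ VNP` NOT proved.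
-/

set_option linter.dupNamespace false

namespace Summit.ValiantsHypothesis.ValiantsHypothesis.Theorems.RigidityForcesSymmetryRankRigidMinimalRepr

namespace LaplaceFiveStar

open Finset MvPolynomial Module LaplaceFiveSectorSplit

variable {N : ℕ}

/-- **K1 ON THE STAR.**  A side-symmetric pair-split decomposition of `P₅` whose four splits form a star has Laplace weight
`≥ 5! = 120` (at least ten terms); paper proof of record: memo `NOTE-p4g15-24813-K1-star.md` (refereed, R332). [folklore] -/
theorem sideSym_starPairSplits (T : Finset (Fin N)) (S : Fin N → Finset (Fin 5))
    (u w : Fin N → (Fin 5 → Fin 5) → ℂ) (hdec : IsSplitDecomposition T S u w) (hsym : SideSymmetric T S u w)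
    (hpair : ∀ t ∈ T, (S t).card = 2) (h4 : (T.image S).card = 4) (hstar : ∃ c : Fin 5, ∀ A ∈ T.image S, c ∈ A) :
    Nat.factorial 5 ≤ laplaceWeight T S := by
  classical
  rcases star_profile_reduction T S u w hdec hsym hpair h4 hstar with h | ⟨hT9, A₁, A₂, A₃, hA₁, hA₂, hA₃, h12, h13, h23,
    htwo₁, htwo₂, htwo₃⟩
  · exact h
  obtain ⟨p, a, b, c, d, hpa, hpb, hpc, hpd, hab, hac, had, hbc, hbd, hcd, hA₁e, hI, -⟩ :=
    two_term_reading T S u w hdec hsym hpair h4 hstar A₁ hA₁ htwo₁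
  rw [hA₁e] at htwo₁ h12 h13
  have main : ∀ x y z : Fin 5, p ≠ x → p ≠ y → p ≠ z → a ≠ x → a ≠ y → a ≠ z → x ≠ y → x ≠ z → y ≠ z →
      T.image S = {({p, a} : Finset (Fin 5)), {p, x}, {p, y}, {p, z}} →
      (T.filter (fun t => S t = {p, x})).card = 2 → (T.filter (fun t => S t = {p, y})).card = 2 →
      Nat.factorial 5 ≤ laplaceWeight T S :=
    fun x y z hpx hpy hpz hax hay haz hxy hxz hyz hI' hx hy =>
      star_main T S u w hdec hsym hpair hstar p a x y z hpa hpx hpy hpz hax hay haz hxy hxz hyz hI' htwo₁ hx hy hT9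
  have hleaf : ∀ X ∈ T.image S, X ≠ {p, a} → X = {p, b} ∨ X = {p, c} ∨ X = {p, d} := by
    intro X hX hne
    rw [hI] at hX
    simp only [Finset.mem_insert, Finset.mem_singleton] at hX
    rcases hX with h | h | h | h
    · exact absurd h hne
    · exact Or.inl h
    · exact Or.inr (Or.inl h)
    · exact Or.inr (Or.inr h)
  -- the six labellings of the two other two-term fibres
  have perm : ∀ x y z : Fin 5, ({({p, a} : Finset (Fin 5)), {p, b}, {p, c}, {p, d}} : Finset (Finset (Fin 5)))
      = {({p, a} : Finset (Fin 5)), {p, x}, {p, y}, {p, z}} ↔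
      ∀ X : Finset (Fin 5), (X = {p, a} ∨ X = {p, b} ∨ X = {p, c} ∨ X = {p, d}) ↔
        (X = {p, a} ∨ X = {p, x} ∨ X = {p, y} ∨ X = {p, z}) := by
    intro x y z
    constructor
    · intro h X
      have := congr_arg (fun s : Finset (Finset (Fin 5)) => X ∈ s) h
      simpa only [Finset.mem_insert, Finset.mem_singleton, eq_iff_iff] using this
    · intro h
      ext X
      simp only [Finset.mem_insert, Finset.mem_singleton]
      exact h X
  rcases hleaf A₂ hA₂ (Ne.symm h12) with rfl | rfl | rfl <;> rcases hleaf A₃ hA₃ (Ne.symm h13) with rfl | rfl | rfl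
  · exact absurd rfl h23
  · exact main b c d hpb hpc hpd hab hac had hbc hbd hcd hI htwo₂ htwo₃
  · exact main b d c hpb hpd hpc hab had hac hbd hbc (Ne.symm hcd) (hI.trans ((perm b d c).mpr fun X => by tauto)) htwo₂ htwo₃
  · exact main c b d hpc hpb hpd hac hab had (Ne.symm hbc) hcd hbd (hI.trans ((perm c b d).mpr fun X => by tauto)) htwo₂ htwo₃
  · exact absurd rfl h23
  · exact main c d b hpc hpd hpb hac had hab hcd (Ne.symm hbc) (Ne.symm hbd) (hI.trans ((perm c d b).mpr fun X => by tauto))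
      htwo₂ htwo₃
  · exact main d b c hpd hpb hpc had hab hac (Ne.symm hbd) (Ne.symm hcd) hbc (hI.trans ((perm d b c).mpr fun X => by tauto))
      htwo₂ htwo₃
  · exact main d c b hpd hpc hpb had hac hab (Ne.symm hcd) (Ne.symm hbd) (Ne.symm hbc)
      (hI.trans ((perm d c b).mpr fun X => by tauto)) htwo₂ htwo₃
  · exact absurd rfl h23

end LaplaceFiveStar

namespace LaplaceFivePropA

open LaplaceFiveSectorSplit

/-- **The named next rung of the young-shadow ladder** (`Cruxes/LaplaceOptimalFive/Lines/shallow_collision.lean`, pen 19:24:16Z,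
R292 (6)): K1 on the star with an explicit hub `p`.  Complements ✓ `sideSym_threePairSplits` (≤ 3 splits) and
✓ `sideSym_fourPairSplits_rigid` (four splits, no hub); memo `NOTE-p4g15-24813-K1-star.md`. [folklore] -/
theorem sideSym_starPairSplits (N : ℕ) (T : Finset (Fin N)) (S : Fin N → Finset (Fin 5))
    (u w : Fin N → (Fin 5 → Fin 5) → ℂ) (hdec : IsSplitDecomposition T S u w) (hsym : SideSymmetric T S u w)
    (hpair : ∀ t ∈ T, (S t).card = 2) (h4 : (T.image S).card = 4) (p : Fin 5) (hstar : ∀ t ∈ T, p ∈ S t) :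
    Nat.factorial 5 ≤ laplaceWeight T S :=
  LaplaceFiveStar.sideSym_starPairSplits T S u w hdec hsym hpair h4
    ⟨p, fun A hA => by
      obtain ⟨t, ht, rfl⟩ := Finset.mem_image.mp hA
      exact hstar t ht⟩

end LaplaceFivePropA

end Summit.ValiantsHypothesis.ValiantsHypothesis.Theorems.RigidityForcesSymmetryRankRigidMinimalRepr
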